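import Literature.NumberTheory.Transcendental.CijsouwWaldschmidt1977Steps
import Literature.NumberTheory.Transcendental.Waldschmidt1980Delta
import Literature.NumberTheory.Transcendental.Waldschmidt1980Endgame
import HarnessLib

/-!
# Waldschmidt 1980, §3.5 on the objects of Cijsouw–Waldschmidt 1977: the asymmetric endgame

Support file (theorems only; no named facts) for the archimedean input of the Stewart–Yu 1991 line
of `Literature.Barriers.ABC.stewartYu1991_upperBound` (M. Waldschmidt, *A lower bound for linear
forms in logarithms*, Acta Arith. **37** (1980), Prop. 3.8 over `ℚ`, `q = 2`).

The tree's `CW77.Setup.endgame` (Cijsouw–Waldschmidt 1977, Step 3) closes the `2`-descent when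
ALL exponent ranges have become empty (`Lⱼ < 2^{J₀}` for every `j` and `L_θ < 2^{J₀}`), which is the
case for Cijsouw–Waldschmidt's symmetric parameters. In Waldschmidt 1980 the ranges
`Lⱼ = [U/(c₁c₂nq^{n+1}DSVⱼ)]` are different for different `j` ((3.2), p. 264) and the descent stops
as soon as the SMALLEST one — that of the eliminated logarithm, here `θ` — is empty
(`J₀ = [log Lₙ/log q] + 1`, p. 274); the other `λⱼ` are then removed by the Vandermonde argument in
the derivatives `τⱼ` and the `Δ`-polynomials by a zero count (§3.5). This file transports the
abstract form of that argument (`Waldschmidt1980.endgame`) to the objects of the tree's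
Cijsouw–Waldschmidt files:

* `qΔ_top_eq` — at the top level `J = J₀` the `Δ`-factor is `τ₀! · ((1/τ₀!) d^{τ₀} w_ρ)(s)` with the
  RATIONAL polynomial `w_ρ = wPolyQ r l h`;
* `coreSum_top_eq` — `coreSum_{J₀,τ}(s) = τ₀! ∑_ρ ∑_λ p(ρ,λ,0) ((1/τ₀!)d^{τ₀}w_ρ)(s) ∏ⱼ αⱼ^{sλⱼ} λⱼ^{τⱼ}`
  when `L_θ < 2^{J₀}`;
* `w80_endgame` — **§3.5**: the invariant `Inv` at level `J₀` with `L_θ < 2^{J₀}`,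
  `T' + ∑ⱼ ⌊Lⱼ/2^{J₀}⌋ ≤ ⌊T/2^{J₀}⌋` and `h · Lb < T' · #{odd s < 2^{J₀} S₀}` is contradictory.

## References

* [Waldschmidt1980] M. Waldschmidt, *A lower bound for linear forms in logarithms*, Acta Arith. 37
  (1980), 257–283 — §3.5 (p. 274).
* [CijsouwWaldschmidt1977] P. L. Cijsouw, M. Waldschmidt, Compositio Math. 34 (1977) — §4
  Step 3 (the tree's `CW77.Setup.endgame`, the symmetric case).
-/

noncomputable section

open Complex Finset Polynomial
open Literature.NumberTheory.Transcendental.Baker1975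
open Literature.NumberTheory.Transcendental.Baker1975.Ch3
open Literature.NumberTheory.Transcendental.Waldschmidt1980

namespace Literature.NumberTheory.Transcendental.CW77

namespace Setup

variable (S : Setup) {h Lb : ℕ}

/-- **At the top level the `Δ`-factor is a Hasse derivative of the rational polynomial `w_ρ`**:
`qΔ_{J₀,J₀}(u, τ₀, s) = τ₀! · ((1/τ₀!) d^{τ₀} wPolyQ r l h)(s)`. [folklore] -/
theorem qΔ_top_eq (J₀ : ℕ) (u : Idx S.d h Lb) (τ₀ s : ℕ) :
    S.qΔ J₀ J₀ u τ₀ s =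
      (τ₀.factorial : ℚ) * (hasseDeriv τ₀ (wPolyQ (u.1.1 : ℕ) (u.1.2 : ℕ) h)).eval (s : ℚ) := by
  have hC : (S.qΔ J₀ J₀ u τ₀ s : ℂ) =
      (((τ₀.factorial : ℚ) * (hasseDeriv τ₀ (wPolyQ (u.1.1 : ℕ) (u.1.2 : ℕ) h)).eval (s : ℚ) : ℚ) : ℂ) := by
    rw [← S.Qw_wOf_natCast, Qw_zero_right]
    unfold wOf
    rw [Nat.sub_self, pow_zero, Nat.cast_one, C_1, one_mul, comp_X, ← map_wPolyQ,
      iterate_derivative_map, eval_map, show ((s : ℂ)) = algebraMap ℚ ℂ (s : ℚ) by simp,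
      eval₂_at_apply, iterate_derivative_eval_eq_factorial_mul_hasseDeriv_eval]
    simp
  exact_mod_cast hC

/-- The box of the top level has `λ_θ = 0` when `L_θ < 2^{J₀}`. [folklore] -/
theorem mem_box_top_iff {L : Fin S.d → ℕ} {Lθ J₀ : ℕ} (hLθ : Lθ < 2 ^ J₀) {u : Idx S.d h Lb} :
    u ∈ S.box (h := h) (Lb := Lb) L Lθ J₀ ↔ (∀ j, u.2.1 j ≤ L j / 2 ^ J₀) ∧ u.2.2 = 0 := by
  rw [S.mem_box, Nat.div_eq_of_lt hLθ, Nat.le_zero]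

/-- **The rational core at the top level, as a double sum over `ρ` and the box `∏ⱼ[0, ⌊Lⱼ/2^{J₀}⌋]`**:
`coreSum_{J₀,τ}(s) = τ₀! ∑_ρ ∑_λ p(ρ,λ,0) · ((1/τ₀!)d^{τ₀}w_ρ)(s) · ∏ⱼ (αⱼ^{sλⱼ} λⱼ^{τⱼ})`
(`L_θ < 2^{J₀}`, so `λ_θ = 0`, `γⱼ = λⱼ`, `qE = ∏ αⱼ^{λⱼ s}`). [cite: Waldschmidt1980, §3.5 (p. 274)] -/
theorem coreSum_top_eq {L : Fin S.d → ℕ} {Lθ J₀ : ℕ} (hLθ : Lθ < 2 ^ J₀)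
    (p : Idx S.d h Lb → ℤ) (τ : Tau S.d) (s : ℕ) :
    S.coreSum J₀ J₀ (S.box (h := h) (Lb := Lb) L Lθ J₀) p τ s =
      (τ.1.factorial : ℚ) * ∑ ρ : Fin h × Fin Lb, ∑ lam : ∀ j : Fin S.d, Fin (L j / 2 ^ J₀ + 1),
        (p (ρ, (fun j => ((lam j : ℕ)), 0)) : ℚ) *
          (hasseDeriv τ.1 (wPolyQ (ρ.1 : ℕ) (ρ.2 : ℕ) h)).eval (s : ℚ) *
          ∏ j, ((S.α j) ^ (s * (lam j : ℕ)) * (((lam j : ℕ) : ℚ)) ^ (τ.2 j)) := by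
  classical
  unfold coreSum box
  rw [Nat.div_eq_of_lt hLθ, zero_add, Finset.sum_product, Finset.mul_sum]
  refine Finset.sum_congr rfl fun ρ _ => ?_
  rw [Finset.sum_product, Finset.mul_sum]
  simp only [Finset.sum_range_one]
  -- the sum over `piFinset` as a sum over the dependent box
  symm
  refine Finset.sum_bij' (fun lam _ => fun j => ((lam j : ℕ)))
    (fun μ hμ => fun j => ⟨μ j, mem_range.mp (Fintype.mem_piFinset.mp hμ j)⟩) ?_ ?_ ?_ ?_ ?_
  · intro lam _; exact Fintype.mem_piFinset.mpr fun j => mem_range.mpr (lam j).isLt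
  · intro μ _; exact mem_univ _
  · intro lam _; rfl
  · intro μ _; rfl
  · intro lam _
    unfold qTerm qA qE γ
    rw [S.qΔ_top_eq]
    simp only [Nat.cast_zero, zero_mul, add_zero, pow_zero, mul_one]
    rw [Finset.prod_mul_distrib]
    have hcomm : ∀ j : Fin S.d, (S.α j) ^ ((lam j : ℕ) * s) = (S.α j) ^ (s * (lam j : ℕ)) := by
      intro j; rw [mul_comm]
    simp_rw [hcomm]
    ring

/-- Distinct degrees `r + l h` (`r < h`) of the rational family `ρ ↦ wPolyQ r l h`. [folklore] -/
theorem injective_natDegree_wPolyQ (h Lb : ℕ) :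
    Function.Injective fun ρ : Fin h × Fin Lb => (wPolyQ (ρ.1 : ℕ) (ρ.2 : ℕ) h).natDegree := by
  intro ρ ρ' hρ
  simp only [natDegree_wPolyQ] at hρ
  have ha := ρ.1.isLt
  have ha' := ρ'.1.isLt
  have hpos : 0 < h := by omega
  have hdiv : (ρ.2 : ℕ) = (ρ'.2 : ℕ) := by
    have h1 : ((ρ.1 : ℕ) + (ρ.2 : ℕ) * h) / h = ((ρ'.1 : ℕ) + (ρ'.2 : ℕ) * h) / h := by rw [hρ]
    rwa [Nat.add_mul_div_right _ _ hpos, Nat.add_mul_div_right _ _ hpos,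
      Nat.div_eq_of_lt ha, Nat.div_eq_of_lt ha', zero_add, zero_add] at h1
  have hmod : (ρ.1 : ℕ) = (ρ'.1 : ℕ) := by rw [hdiv] at hρ; omega
  exact Prod.ext (Fin.ext hmod) (Fin.ext hdiv)

/-- **Waldschmidt 1980, §3.5 — the contradiction at the top of the descent, for DIFFERENT ranges
`Lⱼ`.** If the invariant `Inv` holds at the level `J₀` where the range of the eliminated exponent is
empty (`L_θ < 2^{J₀}`), the derivative budget `⌊T/2^{J₀}⌋` covers a box `τ₀ < T'`,
`τⱼ ≤ ⌊Lⱼ/2^{J₀}⌋`, and `h · Lb < T' · #{odd s < 2^{J₀} S₀}`, then we have a contradiction: by the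
Vandermonde argument in the `τⱼ` and the zero count for the `Δ`-polynomials
(`Waldschmidt1980.endgame`) all the `p(u)` vanish. [cite: Waldschmidt1980, §3.5 (p. 274)] -/
theorem w80_endgame {J₀ : ℕ} {L : Fin S.d → ℕ} {Lθ S₀ T : ℕ} {P : ℤ} {p : Idx S.d h Lb → ℤ}
    (inv : S.Inv J₀ L Lθ S₀ T P J₀ p) (hLθ : Lθ < 2 ^ J₀) {T' : ℕ}
    (hT' : T' + ∑ j, L j / 2 ^ J₀ ≤ T / 2 ^ J₀)
    (hcount : h * Lb < T' * ((range (2 ^ J₀ * S₀)).filter Odd).card) : False := by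
  classical
  set L' : Fin S.d → ℕ := fun j => L j / 2 ^ J₀ with hL'
  set boxJ := S.box (h := h) (Lb := Lb) L Lθ J₀ with hboxJ
  set pts : Finset ℕ := (range (2 ^ J₀ * S₀)).filter Odd with hpts
  set p' : (Fin h × Fin Lb) → (∀ j : Fin S.d, Fin (L' j + 1)) → ℚ :=
    fun ρ lam => (p (ρ, (fun j => ((lam j : ℕ)), 0)) : ℚ) with hp'
  -- the vanishing in the form of `Waldschmidt1980.endgame`
  have hvan : ∀ s ∈ pts, ∀ k < T', ∀ τb : ∀ j : Fin S.d, Fin (L' j + 1),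
      ∑ ρ : Fin h × Fin Lb, ∑ lam : ∀ j : Fin S.d, Fin (L' j + 1),
        p' ρ lam * (hasseDeriv k (wPolyQ (ρ.1 : ℕ) (ρ.2 : ℕ) h)).eval ((fun n : ℕ => (n : ℚ)) s) *
          ∏ j, ((S.α j) ^ (s * (lam j : ℕ)) * (((lam j : ℕ) : ℚ)) ^ ((τb j : ℕ))) = 0 := by
    intro s hs k hk τb
    rw [hpts, mem_filter, mem_range] at hs
    set τ : Tau S.d := (k, fun j => (τb j : ℕ)) with hτ
    have hτn : tauNorm τ < T / 2 ^ J₀ := by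
      show k + ∑ j, (τb j : ℕ) < T / 2 ^ J₀
      have hle : ∑ j, (τb j : ℕ) ≤ ∑ j, L' j :=
        Finset.sum_le_sum fun j _ => Nat.lt_succ_iff.mp (τb j).isLt
      have hT'' : T' + ∑ j, L' j ≤ T / 2 ^ J₀ := hT'
      omega
    have hrel := inv.rel s hs.1 hs.2 τ hτn
    rw [S.coreSum_top_eq hLθ p τ s] at hrel
    have hk0 : (k.factorial : ℚ) ≠ 0 := by exact_mod_cast (Nat.factorial_pos k).ne'
    have h0 := (mul_eq_zero.mp hrel).resolve_left hk0
    simpa [hp', hτ] using h0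
  have hend := Waldschmidt1980.endgame (K := ℚ) (fun ρ : Fin h × Fin Lb => wPolyQ (ρ.1 : ℕ) (ρ.2 : ℕ) h)
    (fun ρ => wPolyQ_ne_zero _ _ _) (injective_natDegree_wPolyQ h Lb) (N := h * Lb)
    (fun ρ => by
      rw [natDegree_wPolyQ]
      have h1 := ρ.1.isLt; have h2 := ρ.2.isLt
      have h3 : ((ρ.2 : ℕ) + 1) * h = (ρ.2 : ℕ) * h + h := by ring
      have h4 : ((ρ.2 : ℕ) + 1) * h ≤ Lb * h := Nat.mul_le_mul_right h h2
      rw [mul_comm h Lb]; omega)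
    L' (fun j => S.α j) (fun j => (S.α_pos j).ne') pts (fun n : ℕ => (n : ℚ))
    (fun a _ b _ hab => Nat.cast_injective (R := ℚ) hab) T' hcount p' hvan
  -- all `p(u)` vanish
  apply (inv.nonzero).elim
  intro u hu
  by_cases hmem : u ∈ boxJ
  · rw [S.mem_box_top_iff hLθ] at hmem
    obtain ⟨hμ, hθ⟩ := hmem
    have hlam : p' u.1 (fun j => ⟨u.2.1 j, Nat.lt_succ_of_le (hμ j)⟩) = 0 := by
      rw [hend]; rfl
    simp only [hp'] at hlam
    have hu_eq : u = (u.1, (fun j => u.2.1 j, 0)) := by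
      rcases u with ⟨ρ, μ, lθ⟩
      simp only at hθ ⊢
      rw [hθ]
    rw [hu_eq] at hu
    exact hu (by exact_mod_cast hlam)
  · exact hmem (inv.supp u hu)

end Setup

end Literature.NumberTheory.Transcendental.CW77

end
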